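import Summits.ABC.IUTFork.Joshi.FrobenioidsJoshi
import Summits.ABC.IUTFork.Joshi.ThetaValuesLocus

/-!
# Joshi, ATS III (arXiv 2401.13508v4) Prop. 10.3.3: the diagram (10.3.4) commutes for SOME Frobenioid
# isomorphism iff the rescaling exponent is `1`; the instance on E-t3's period-ring points `y` (`scale y`)

Proof-only companion (abc-iut cell, branch E, seat abc-iut-E-t34, slot T-34a; §10 RULING of E-plan-2 07:28:52Z (3):
E-t34's Prop. 10.3.3 proofs are stated as DISCHARGES over seat E-t32's carriers of `Joshi/FrobenioidsJoshi.lean`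
(p430621: `Frob.FrobIso`, `Frob.FrobIso.DegCompatible`, claim-Props `Frob.Prop1033_1` / `Frob.Prop1033_2`,
`Frob.prop1033_of_rpow`) — imported BY NAME, no second claim-Prop; rung LADDER-ABC:A2.E). TAKES NO SIDE on
[IUTchIII] Cor. 3.12 or on any author; typed ≠ proved; every statement below is kernel-checked, nothing is asserted.
Locators "p.N l.M" = PDF page / line of `HOME/lit/renders/Joshi-arxiv-2401.13508/`. [claim: Joshi2024ATS3, status: disputed]

WHAT. (1) `exists_degCompatible_iff_exponent_eq_one`: for a DILATATION `|−|₂ = |−|₁^c` (`c > 0`) of absolute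
values on a field `E` having an element of absolute value `≠ 0, 1` (print: `p`), "there [exists an] isomorphism of
the two Frobenioid structures … compatible with identity homomorphism on `ℝ` in the arithmetic degree homomorphisms"
(Prop. 10.3.3 (2), p.132 l.4–7; diagram (10.3.4), p.132 l.15–21) IFF `c = 1` — E-t32's `prop1033_of_rpow` is the
direction `c ≠ 1 ⇒ none`; the converse is the identity isomorphism. Hence `prop1033_2_iff_exponent_ne_one`. This is
the kernel form of Joshi's "if the valuation of `p` in `ℂ_p` and valuation of `p` in `K` do not coincide" (p.132
l.22): the obstruction IS the rescaling exponent (plan/E/E-PLAN.md §2 load-bearing sentence; located, not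
adjudicated). (2) THE INSTANCE print has in mind ("in general it is possible to find untilts `K` such that this
happens", p.132 l.22–23): on seat E-t3's landed `Summit.ABC.IUTFork.Joshi.PeriodRingDatum` (Joshi/ThetaValuesLocus.
lean, [J-IIp] arXiv 2303.01662v3 §2/§6: points `y` of the Fargues–Fontaine curve with untilts `K_y`, embeddings
`ι_y = emb y : Ē → K_y`, `absK_emb : |ι_y(z)|_{K_y} = |z|_0^{scale y}`, `0 < |p|_0 < 1`) the two Frobenioid structures
on `Ē` — the reference one `abs0` ("induced by `E ↪ ℂ_p`") and the one induced by `ι_y` — are abstractly isomorphic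
and NOT degree-compatibly isomorphic exactly when `scale y ≠ 1` (`prop1033_periodRing`,
`exists_degCompatible_periodRing_iff`). No new hypothesis: only E-t3's fields.
-/

noncomputable section

namespace Summit.ABC.IUTFork.Joshi.ATS3.Frob

universe u

section Dilatation

variable {E : Type u} [Field E] {v₁ v₂ : AbsoluteValue E ℝ}

/-- Equal absolute values have degree-compatibly isomorphic elementary Frobenioids (the identity; the trivial
direction of Prop. 10.3.3 (2)). [folklore] -/
theorem exists_degCompatible_of_eq (h : v₁ = v₂) : ∃ e : FrobIso v₁ v₂, e.DegCompatible := by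
  subst h
  exact ⟨⟨MulEquiv.refl _, fun _ => rfl, fun _ => Iff.rfl⟩, fun _ => rfl⟩

/-- **Prop. 10.3.3 (2) as an equivalence** (p.132 l.4–23): for a dilatation `|−|₂ = |−|₁ ^ c`, `0 < c`, on a field
with an element `x` of absolute value `|x|₁ ≠ 0, 1` (print: `x = p`), a Frobenioid isomorphism making (10.3.4)
commute EXISTS iff `c = 1` ("if the valuation of `p` in `ℂ_p` and valuation of `p` in `K` do not coincide … there may
not exist any commutative diagram"). [claim: Joshi2024ATS3, status: disputed] -/
theorem exists_degCompatible_iff_exponent_eq_one {c : ℝ} (hc : 0 < c) (h : ∀ y : E, v₂ y = v₁ y ^ c)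
    {x : Eˣ} (hx1 : v₁ (x : E) ≠ 1) : (∃ e : FrobIso v₁ v₂, e.DegCompatible) ↔ c = 1 := by
  constructor
  · intro he
    by_contra hc1
    exact (prop1033_of_rpow hc hc1 h hx1).2 he
  · intro hc1
    subst hc1
    refine exists_degCompatible_of_eq (AbsoluteValue.ext fun y => ?_)
    rw [h, Real.rpow_one]

/-- **E-t32's claim-Prop `Prop1033_2` ("no degree-compatible isomorphism") holds iff the exponent is `≠ 1`**, for a
dilatation as above. [claim: Joshi2024ATS3, status: disputed] -/
theorem prop1033_2_iff_exponent_ne_one {c : ℝ} (hc : 0 < c) (h : ∀ y : E, v₂ y = v₁ y ^ c)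
    {x : Eˣ} (hx1 : v₁ (x : E) ≠ 1) : Prop1033_2 v₁ v₂ ↔ c ≠ 1 :=
  (exists_degCompatible_iff_exponent_eq_one hc h hx1).not

/-- … while `Prop1033_1` ("abstractly isomorphic") holds for EVERY exponent (`c = 1`: identity; `c ≠ 1`: E-t32's
`prop1033_of_rpow`). [claim: Joshi2024ATS3, status: disputed] -/
theorem prop1033_1_of_rpow' {c : ℝ} (hc : 0 < c) (h : ∀ y : E, v₂ y = v₁ y ^ c) {x : Eˣ} (hx1 : v₁ (x : E) ≠ 1) :
    Prop1033_1 v₁ v₂ := by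
  by_cases hc1 : c = 1
  · subst hc1
    have : v₁ = v₂ := AbsoluteValue.ext fun y => by rw [h, Real.rpow_one]
    subst this
    exact ⟨⟨MulEquiv.refl _, fun _ => rfl, fun _ => Iff.rfl⟩⟩
  · exact (prop1033_of_rpow hc hc1 h hx1).1

end Dilatation

/-! ## The instance on E-t3's period-ring points (Joshi's "untilts `K` such that this happens") -/

section PeriodRing

variable {F B E0 : Type} [Field F] [CommRing B] [Field E0] {Y : Type} {K : Y → Type} [∀ y, Field (K y)]
  {G : Type} (D : PeriodRingDatum F B E0 Y K G)

/-- At a point `y`, the Frobenioid structure on `Ē` induced by `ι_y : Ē ↪ K_y` ((10.3.2); E-t32's `Frob.induced`) is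
the dilatation of the reference one by `scale y` — E-t3's field `absK_emb`. [claim: Joshi2023ATS2Local, status: disputed] -/
theorem induced_emb_apply (y : Y) (z : E0) : induced (D.absK y) (D.emb y) z = D.abs0 z ^ D.scale y := by
  rw [induced_apply, D.absK_emb]

/-- `p ≠ 0` in `Ē` (from `0 < |p|_0`). [folklore] -/
theorem natCast_p_ne_zero : (D.p : E0) ≠ 0 := D.abs0.pos_iff.mp D.abs0_p.1

/-- **Prop. 10.3.3 at a period-ring point `y` with `scale y ≠ 1`**: the structures `Frob(Ē, |−|_0)` and
`Frob(Ē, |−|_{K_y})` are abstractly isomorphic (1) and admit NO degree-compatible isomorphism (2) — E-t32's claim-Props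
DISCHARGED on E-t3's carriers, witness `x = p` (`0 < |p|_0 < 1`, E-t3's `abs0_p`). [claim: Joshi2024ATS3, status: disputed] -/
theorem prop1033_periodRing (y : Y) (hy : D.scale y ≠ 1) :
    Prop1033_1 D.abs0 (induced (D.absK y) (D.emb y)) ∧ Prop1033_2 D.abs0 (induced (D.absK y) (D.emb y)) :=
  prop1033_of_rpow (D.scale_pos y) hy (induced_emb_apply D y) (x := Units.mk0 (D.p : E0) (natCast_p_ne_zero D))
    (ne_of_lt D.abs0_p.2)

/-- **(10.3.4) commutes at `y` for some isomorphism iff `scale y = 1`** — the kernel form of "if the valuation of `p`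
in `ℂ_p` and valuation of `p` in `K` do not coincide (and in general it is possible to find untilts `K` such that
this happens)" (p.132 l.22–23) on E-t3's carriers: the obstruction is exactly the rescaling exponent of the untilt.
[claim: Joshi2024ATS3, status: disputed] -/
theorem exists_degCompatible_periodRing_iff (y : Y) :
    (∃ e : FrobIso D.abs0 (induced (D.absK y) (D.emb y)), e.DegCompatible) ↔ D.scale y = 1 :=
  exists_degCompatible_iff_exponent_eq_one (D.scale_pos y) (induced_emb_apply D y)
    (x := Units.mk0 (D.p : E0) (natCast_p_ne_zero D)) (ne_of_lt D.abs0_p.2)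

/-- For EVERY point `y` the two structures are abstractly isomorphic (Prop. 10.3.3 (1) needs no hypothesis on `y`).
[claim: Joshi2024ATS3, status: disputed] -/
theorem prop1033_1_periodRing (y : Y) : Prop1033_1 D.abs0 (induced (D.absK y) (D.emb y)) :=
  prop1033_1_of_rpow' (D.scale_pos y) (induced_emb_apply D y) (x := Units.mk0 (D.p : E0) (natCast_p_ne_zero D))
    (ne_of_lt D.abs0_p.2)

end PeriodRing

end Summit.ABC.IUTFork.Joshi.ATS3.Frob

end
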